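import Summits.BirchSwinnertonDyer.BirchSwinnertonDyer.Theorems.ThetaPartnerAtTwoSignedMainConjectureCMTwoRankZeroOfLocal
import Summits.BirchSwinnertonDyer.BirchSwinnertonDyer.Theorems.ThetaPartnerAtTwoSignedControlAtTwoCoinvOfResTwo
import Summits.BirchSwinnertonDyer.BirchSwinnertonDyer.Theorems.ThetaPartnerAtTwoSignedControlAtTwoShaTwoPrimaryVanishing
import Summits.BirchSwinnertonDyer.BirchSwinnertonDyer.Theorems.ThetaPartnerAtTwoSignedControlAtTwoCasselsOfPT
import Literature.NumberTheory.EllipticCurves.Kobayashi2003.SignedSelmerModuleFiniteProofs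
import HarnessLib

/-!
# (EC2)_A and (T) «`X⁺(A/ℚ_∞)` is `Λ`-torsion at analytic rank `0`» FROM THE FOUR GENERIC POITOU–TATE ROWS OVER `ℚ` —
# Greenberg's five structure facts (Prop. 4.13, Prop. 4.12, pp. 119–120, p. 108, §5 p. 140) LEAVE the torsion input of
# crux K2r0P `SignedMainConjectureCMTwoRankZeroOfPub` (stmt-BirchSwinnertonDyer-24945, route `ThetaPartnerAtTwo`, line `rankzero`)

Seat `bsd-inputs-k4-p1` (ASIDE seat of the K4 Greenberg-1999 inputs; no claim).  THEOREMS ONLY (no definition, no named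
fact, no `sorry`); Gross–Zagier–Kolyvagin (`rank_eq_analyticRank_of_analyticRank_le_one`) and the four Poitou–Tate rows
{`poitouTate_selmerStructure_duality ℚ`, `poitouTate_sha_tateDual ℚ`, `poitouTate_three_realPlaces_injective ℚ`,
`poitouTate_two_realPlaces_surjective ℚ`} enter as HYPOTHESES BY NAME (conditional results).

The line's `signedTorsionTwoRankZero_of_pub` (`…CMTwoRankZeroOfLocal` / `…OfPubOfStubs`) derives (T) from GZK and
Greenberg's FIVE printed structure facts {`casselsSurjectivity_H1Sigma`, `prop412_noFiniteSubmodule_H1Sigma_of_rank_one`,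
`h1Sigma_zpCorank_le_degree`, `localQuotient_restriction_surjective`, `h1SigmaInfty_rank_eq_one`} through the EC2 door
`signedEulerCharTwo_at_of_local`.  The K4 lineage has since re-keyed EC2: width seat w2's
`SignedEC.ResTwo.signedEulerChar_two_of_cassels_of_resTwo` (EC2 ⟸ CASSELS + `res : H²(ℚ, E[2^∞]) ↪ H²(ℚ_∞, E[2^∞])`),
`SignedEC.ResTwo.resTwo_injective_of_shaTwo` (`hres` ⟸ `Ш²(ℚ, E[2^∞]) = 0`),
`SignedEC.ShaTwo.stub_shaTwoPrimaryVanishing_of_poitouTate` (`Ш² = 0` ⟸ PT(a), 4.10(c)₃, 4.16 over `ℚ`) and w3's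
`SignedEC.CasselsPT.casselsSurjectivity_H1Sigma_of_poitouTate` (CASSELS ⟸ PT(b)).  This file composes them for K2r0P:

* `signedEulerCharTwo_of_poitouTate_four` — (EC2)_A for EVERY globally minimal `A/ℚ` good supersingular at `2` with
  `a₂ = 0`, every cyclotomic `κ` / topological generator `γ`, `Sel_{2^∞}(A/ℚ)` finite ⟸ the four PT rows;
* `signedTorsionTwoRankZero_of_poitouTate` — (T): the conclusion of `signedTorsionTwoRankZero_of_pub` VERBATIM
  (`∀ A …, analyticRank = 0 → GoodSS A 2 → a₂ = 0 → ∀ κ γ …, ∀ D, Module.IsTorsion Λ D.X`) ⟸ GZK + the four PT rows —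
  so in the PUB¹⁰ of K2r0P the block «Greenberg⁵» may be replaced by «PT⁴» (generic class-field theory over `ℚ`) for
  the torsion input; the remaining uses of Greenberg⁵ in the line (`…_at_of_pub_of_lowerUpToTwoPower_of_flat`,
  `…_at_unitZone_of_pub`) go through the same EC2 door and admit the same substitution (planner's restatement).

BSD is not proved by any of this; no summit statement is proved by this seat; item 24945 is NOT closed; closes nothing.

References: [Kobayashi2003] Thm. 1.2, §8.4; [BDKim2013] Cor. 3.15; [GreenbergLNM1716] §1 p. 61, §4 Lemma 4.2, Props.
4.12–4.13; [MilneADT2006] I Thm. 4.10, Cor. 4.16, Thm. 6.13 (c); [Kolyvagin1990] Thm. A; [GrossZagier1986] Thm. I.6.3.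
-/

set_option autoImplicit false
-- the Theorems namespace of this sub repeats the summit name by design (D-0017 nested layout)
set_option linter.dupNamespace false

noncomputable section

open scoped Classical NumberField

open NumberField IsDedekindDomain

namespace Summit.BirchSwinnertonDyer.BirchSwinnertonDyer.Theorems.SignedEC.TorsionPT

open Literature.NumberTheory.EllipticCurves Literature.NumberTheory.GaloisRepresentations
  Literature.NumberTheory.GaloisCohomology WeierstrassCurve ZpExtension
  Literature.NumberTheory.EllipticCurves.Kobayashi2003 Literature.NumberTheory.EllipticCurves.IwasawaDual
  Literature.NumberTheory.EllipticCurves.IwasawaAlgebra Literature.NumberTheory.EllipticCurves.Rank1Residual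

/-- **(EC2)_A from the four generic Poitou–Tate rows over `ℚ`**: for every globally minimal `A/ℚ` with good supersingular
reduction at `2` and `a₂ = 0`, every cyclotomic `ℤ₂`-extension `κ` with topological generator `γ`, and `Sel_{2^∞}(A/ℚ)`
finite: `Sel⁺(A/ℚ_∞)^γ` is finite and `#Sel⁺_∞^γ = u·2^{v₂∏c_ℓ}·#Sel_{2^∞}(A/ℚ)·#(Sel⁺_∞)_γ` — w2's
`signedEulerChar_two_of_cassels_of_resTwo` with CASSELS from PT(b) and `hres` from `Ш²(ℚ, E[2^∞]) = 0` ⟸ {PT(a),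
4.10(c)₃, 4.16}(ℚ). No Greenberg-1999 / Kato input. [cite: BDKim2013, Cor. 3.15 (p. 199)]
[cite: GreenbergLNM1716, §4 Lemma 4.7, Prop. 4.13 / p. 122] [cite: MilneADT2006, Ch. I, Thm. 4.10, Cor. 4.16, Thm. 6.13 (c)] -/
theorem signedEulerCharTwo_of_poitouTate_four (hPTb : poitouTate_selmerStructure_duality ℚ)
    (hPT : poitouTate_sha_tateDual ℚ) (h3 : poitouTate_three_realPlaces_injective ℚ)
    (h2 : poitouTate_two_realPlaces_surjective ℚ)
    (A : WeierstrassCurve ℚ) [A.IsElliptic] [A.IsGloballyMinimal] (hss : GoodSS A 2) (ha : A.frobeniusTrace 2 = 0)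
    (κ : ZpExtension ℚ 2) (hκ : κ.IsCyclotomic) {γ : Field.absoluteGaloisGroup ℚ} (hγ : κ.IsTopGenerator γ)
    (hSel : Finite (A.selmerGroupPInfty 2)) :
    Finite (endInvariants (conjSignedSelmerInfty A κ 1 γ - 1)) ∧
      ∃ u : ℤ_[2]ˣ, (Nat.card (endInvariants (conjSignedSelmerInfty A κ 1 γ - 1)) : ℚ_[2]) =
        ((u : ℤ_[2]) : ℚ_[2]) * ((2 : ℕ) : ℚ_[2]) ^ (padicValNat 2 A.tamagawaProduct) *
          (Nat.card (A.selmerGroupPInfty 2) : ℚ_[2]) *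
            (Nat.card (EndCoinvariants (conjSignedSelmerInfty A κ 1 γ - 1)) : ℚ_[2]) :=
  SignedEC.ResTwo.signedEulerChar_two_of_cassels_of_resTwo A κ hss ha hκ hγ
    (SignedEC.CasselsPT.casselsSurjectivity_H1Sigma_of_poitouTate hPTb)
    (SignedEC.ResTwo.resTwo_injective_of_shaTwo A κ hss
      (SignedEC.ShaTwo.stub_shaTwoPrimaryVanishing_of_poitouTate hPT h3 h2 A hss ha hSel))
    hSel

/-- **(T) — `X⁺(A/ℚ_∞)` is `Λ`-torsion at analytic rank `0` — FROM GZK AND THE FOUR POITOU–TATE ROWS** (the conclusion of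
the line's `signedTorsionTwoRankZero_of_pub` verbatim, its «Greenberg⁵» block replaced by «PT⁴»): GZK gives
`Sel_{2^∞}(A/ℚ)` finite (`finite_selmerGroupPInfty_two_of_analyticRank_eq_zero`), (EC2)_A gives `Sel⁺_∞^γ` finite, and a
finite `Sel⁺_∞^γ` forces torsion (`SignedSelmerDualData.isTorsion_of_finite_endInvariants`).
[cite: Kobayashi2003, Thm. 1.2 (p. 2), §8.4] [cite: BDKim2013, Cor. 3.15 (p. 199)] [cite: GreenbergLNM1716, §1 p. 61, §4 Lemma 4.2]
[cite: MilneADT2006, Ch. I, Thm. 4.10, Cor. 4.16] -/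
theorem signedTorsionTwoRankZero_of_poitouTate
    (hGZK : rank_eq_analyticRank_of_analyticRank_le_one)
    (hPTb : poitouTate_selmerStructure_duality ℚ) (hPT : poitouTate_sha_tateDual ℚ)
    (h3 : poitouTate_three_realPlaces_injective ℚ) (h2 : poitouTate_two_realPlaces_surjective ℚ) :
    ∀ (A : WeierstrassCurve ℚ) [A.IsElliptic] [A.IsGloballyMinimal],
      A.analyticRank = 0 → GoodSS A 2 → A.frobeniusTrace 2 = 0 →
      ∀ (κ : ZpExtension ℚ 2) (γ : Field.absoluteGaloisGroup ℚ), κ.IsCyclotomic → κ.IsTopGenerator γ →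
      ∀ D : SignedSelmerDualData A κ γ 1, Module.IsTorsion (IwasawaAlgebra 2) D.X := by
  intro A _ _ hr hss ha κ γ hκ hγ D
  have hSel : Finite (A.selmerGroupPInfty 2) := finite_selmerGroupPInfty_two_of_analyticRank_eq_zero A hGZK hr
  have hEC := signedEulerCharTwo_of_poitouTate_four hPTb hPT h3 h2 A hss ha κ hκ hγ hSel
  exact D.isTorsion_of_finite_endInvariants hγ hEC.1

end Summit.BirchSwinnertonDyer.BirchSwinnertonDyer.Theorems.SignedEC.TorsionPT

end
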